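import Mathlib
import HarnessLib
import Summits.Ventures.LatticeQCDFlow.Exactness.PTBCHeatBathErgodic
import Summits.Ventures.LatticeQCDFlow.Exactness.PTBCPhysicalMarginal
import Summits.Ventures.LatticeQCDFlow.Exactness.NCMCGeneralSpaceDoeblinPowerCLT
import Summits.Ventures.LatticeQCDFlow.Scoring.DoeblinPowerBatchMeansCLT
import Summits.Ventures.LatticeQCDFlow.Scoring.DoeblinPowerBatchMeansTauInt

/-!
# The PTBC cycle (in-replica heat-bath + over-relaxation sweeps, then ANY exact swap / translation move): its one-step Doeblin certificate, and what it buys — every event of the replica product, in particular every event of the physical replica, has a finite `τ_int`; certified burn-in; CLT and asymptotically exact batch-means error bars from EVERY start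

HONEST FRAMING: exact (Metropolis-corrected) sampling algorithms for lattice gauge theory;
figures of merit are autocorrelation/cost numbers at stated couplings and volumes; no
continuum-physics claim.

Venture `LatticeQCDFlow` (cell pub-lqcd), topic `Exactness`, FANOUT row 9 (eng-latcore, GEN-23; the engine
`latflow.core.ptbc`: one PTBC cycle = on every replica `r` (defect coupling `c(r)`) heat-bath sweeps (+ over-relaxation
sweeps), then swap proposals between neighbouring replicas and the translation of the periodic replica; the cell's
R1 figure of merit is `τ_int(Q)` of the PHYSICAL replica).  NEW WORK of the cell over the tree, nothing cited as a
fact, no number claimed: gen-14's `ReplicaProductDoeblin.lean` / `ReplicaProductInvariant.lean` (`replicaSweep`,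
`replicaCycle_minorised_left`, `invariant_pi_replicaSweep`), `PTBCHeatBathErgodic.lean` (`ptbcInReplica`, `ptbcTarget`,
`ptbcInReplica_minorised`, `ptbcInReplica_invariant`, `ptbc_heatBathOR_uniformlyErgodic` — convergence, the Doeblin
constant explicit but not packaged), `PTBCPhysicalMarginal.lean` (`pi_real_preimage_eval`), `RefreshScan.lean`
(`minorised_comp_left`), rows 13 / 8 (`…_of_nHit` consequences).  Printed counterparts NAMED ONLY: Hasenbusch 2017 /
Bonanno–Bonati–D'Elia 2021 (parallel tempering in boundary conditions); Meyn–Tweedie 1993; Flegal–Jones 2010;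
Madras–Sokal 1988.

## Content (replicas `R`, sites `ι`, both finite; reference laws `μ_j` (probability); tempered densities
## `m ≤ p r ≤ M` (`0 < m`, `M < ∞`), measurable; a site scan `l` through every site, a replica scan `L` through every
## replica; `ηr r` ANY Markov kernel on replica `r` leaving `piGibbsLaw μ (p r)` invariant (its OR sweeps); `η` ANY
## Markov kernel on the product leaving `π = ptbcTarget μ p = ⊗_r piGibbsLaw μ (p r)` invariant (swaps, translation);
## `C = η ∘ₖ replicaSweep (fun r => ηr r ∘ₖ ptbcInReplica μ p l r) L` — one PTBC cycle)

* **`ptbc_certificate`** — `C` leaves `π` invariant and `ε' • ν ≤ C(ω, ·) = C^1(ω, ·)` for EVERY joint state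
  `ω`, `0 < ε' ≤ 1`, with the probability law `ν = (⊗_r (⊗μ) ηr_r) η` (ONE cycle forgets its start with
  probability `ε' = ((m/M)^{|l|})^{|L|}`).
* **`ptbc_tauInt_setACF_le`** — ONE `B ≥ 0` with `τ_int(1_A) ≤ 1/2 + B/(1 − π(A))` for EVERY event `A` of the
  replica product with `0 < π(A) < 1`; **`ptbc_physical_tauInt_setACF_le`** — in particular for EVERY event
  `{ω | ω r₀ ∈ B}` of ANY ONE replica `r₀` (the physical one): `τ_int ≤ 1/2 + B'/(1 − π_{r₀}(B))`,
  `π_{r₀} = piGibbsLaw μ (p r₀)` its own tempered law.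
* **`ptbc_timeAverage_bias_le`** — burn-in `B/n` from EVERY start; **`ptbc_timeAverage_clt`**,
  **`ptbc_batchMeans_tendstoInMeasure`**, **`ptbc_batchMeans_coverage`** (`σ²_f > 0`), **`ptbc_tauInt_tendstoInMeasure`**
  (`Var_π f ≠ 0`) — every bounded measurable `f` of the joint state (e.g. an observable of the physical replica),
  EVERY initial law.

NOT CLAIMED: any value of `ε', B` beyond the displayed product of pinching ratios; the swap / translation moves'
own exactness (hypothesis `hη`, typed in `PTBCSwap*.lean` / `PTBCTranslationErgodic.lean`); round-trip or swap
acceptance statistics; that tempering HELPS (the certificate ignores the swaps — it is the in-replica heat bath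
that forgets); the Cabibbo–Marinari in-replica variant (`PTBCCabibboMarinariErgodic.lean`, same argument);
floating point.
-/

noncomputable section

namespace Summit.Ventures.LatticeQCDFlow.Exactness

open MeasureTheory ProbabilityTheory Set Function Filter Topology
open Summit.Ventures.LatticeQCDFlow.Scoring (replicaSEsq tauInt autocov kop)
open scoped ENNReal

section PTBC

variable {R : Type*} {ι : Type*} [DecidableEq ι] {X : ι → Type*} [∀ j, MeasurableSpace (X j)]
variable {μ : ∀ j, Measure (X j)} [∀ j, IsProbabilityMeasure (μ j)] {p : R → (∀ j, X j) → ℝ≥0∞}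
variable [Fintype ι] [Fintype R] [DecidableEq R] {m M : ℝ≥0∞} {l : List ι}

/-- **THE ONE-STEP DOEBLIN CERTIFICATE OF THE PTBC CYCLE.**  In-replica update of replica `r` = the heat-bath scan
`ptbcInReplica μ p l r` followed by ANY Markov `ηr r` leaving its tempered law invariant; then ANY Markov move `η`
on the product leaving `ptbcTarget μ p` invariant.  The cycle `C` leaves `ptbcTarget μ p` invariant and
`ε' • ν ≤ C(ω, ·)` for EVERY joint state `ω`, `0 < ε' ≤ 1`, `ν` the probability law `(⊗_r (⊗μ) ηr_r) η`. -/
theorem ptbc_certificate (hp : ∀ r, Measurable (p r)) (hm0 : m ≠ 0) (hMtop : M ≠ ∞)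
    (hmp : ∀ r ω, m ≤ p r ω) (hpM : ∀ r ω, p r ω ≤ M) (hl : ∀ j, j ∈ l) {L : List R} (hL : ∀ r, r ∈ L)
    (ηr : R → Kernel (∀ j, X j) (∀ j, X j)) [∀ r, IsMarkovKernel (ηr r)]
    (hηr : ∀ r, Kernel.Invariant (ηr r) (piGibbsLaw μ (p r)))
    (η : Kernel (R → ∀ j, X j) (R → ∀ j, X j)) [IsMarkovKernel η] (hη : Kernel.Invariant η (ptbcTarget μ p)) :
    Kernel.Invariant (η ∘ₖ replicaSweep (fun r => ηr r ∘ₖ ptbcInReplica μ p l r) L) (ptbcTarget μ p) ∧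
      IsProbabilityMeasure ((Measure.pi fun r : R => (Measure.pi μ).bind ⇑(ηr r)).bind ⇑η) ∧
      ∃ ε' : ℝ≥0∞, 0 < ε' ∧ ε' ≤ 1 ∧ ∀ ω : (R → ∀ j, X j),
        ε' • ((Measure.pi fun r : R => (Measure.pi μ).bind ⇑(ηr r)).bind ⇑η) ≤
          nHit (η ∘ₖ replicaSweep (fun r => ηr r ∘ₖ ptbcInReplica μ p l r) L) 1 ω := by
  haveI := fun r => isMarkovKernel_ptbcInReplica (μ := μ) (l := l) hp hm0 hMtop hmp hpM r
  haveI : ∀ r, IsProbabilityMeasure (piGibbsLaw μ (p r)) := fun r =>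
    isProbabilityMeasure_piGibbsLaw (μ := μ) hm0 hMtop (hmp r) (hpM r)
  haveI hνr : ∀ r, IsProbabilityMeasure ((Measure.pi μ).bind ⇑(ηr r)) := fun r =>
    ⟨by rw [Measure.bind_apply MeasurableSet.univ (Kernel.aemeasurable _)]; simp⟩
  haveI hν : IsProbabilityMeasure ((Measure.pi fun r : R => (Measure.pi μ).bind ⇑(ηr r)).bind ⇑η) :=
    ⟨by rw [Measure.bind_apply MeasurableSet.univ (Kernel.aemeasurable _)]; simp⟩
  have hinv : Kernel.Invariant (η ∘ₖ replicaSweep (fun r => ηr r ∘ₖ ptbcInReplica μ p l r) L) (ptbcTarget μ p) :=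
    hη.comp (invariant_pi_replicaSweep (π := fun r => piGibbsLaw μ (p r))
      (fun r => (hηr r).comp (ptbcInReplica_invariant hp hm0 hMtop hmp hpM r)) L)
  have hmin : ∀ ω : (R → ∀ j, X j), (((m * M⁻¹) ^ l.length) ^ L.length) • ((Measure.pi fun r : R => (Measure.pi μ).bind ⇑(ηr r)).bind ⇑η) ≤ (η ∘ₖ replicaSweep (fun r => ηr r ∘ₖ ptbcInReplica μ p l r) L) ω :=
    replicaCycle_minorised_left (K := fun r => ηr r ∘ₖ ptbcInReplica μ p l r)
      (ν := fun r => (Measure.pi μ).bind ⇑(ηr r))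
      (fun r x => minorised_comp_left (ptbcInReplica_minorised hp hm0 hMtop hmp hpM hl r) (ηr r) x) hL η
  have hε0 : ((m * M⁻¹) ^ l.length) ^ L.length ≠ 0 :=
    pow_ne_zero _ (pow_ne_zero _ (mul_ne_zero hm0 (ENNReal.inv_ne_zero.2 hMtop)))
  have hε1 : ((m * M⁻¹) ^ l.length) ^ L.length ≤ 1 := by
    obtain ⟨ω⟩ : Nonempty (R → ∀ j, X j) := ⟨fun _ _ => Classical.choice (nonempty_of_isProbabilityMeasure (μ _))⟩
    have h1 := Measure.le_iff'.1 (hmin ω) univ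
    rwa [Measure.smul_apply, smul_eq_mul, measure_univ, measure_univ, mul_one] at h1
  refine ⟨hinv, hν, _, pos_iff_ne_zero.2 hε0, hε1, fun ω => ?_⟩
  rw [GeneralNCMC.nHit_one]
  exact hmin ω

/-! ## Figures of merit of the PTBC chain -/

/-- **EVERY EVENT OF THE REPLICA PRODUCT HAS A FINITE `τ_int` UNDER THE PTBC CYCLE — ONE CONSTANT FOR ALL EVENTS**:
`B ≥ 0` with `τ_int(1_A) ≤ 1/2 + B/(1 − π(A))` (scorers' `Scoring.tauInt`) for EVERY measurable `A` with
`0 < π(A) < 1`, `π = ptbcTarget μ p`. -/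
theorem ptbc_tauInt_setACF_le (hp : ∀ r, Measurable (p r)) (hm0 : m ≠ 0) (hMtop : M ≠ ∞)
    (hmp : ∀ r ω, m ≤ p r ω) (hpM : ∀ r ω, p r ω ≤ M) (hl : ∀ j, j ∈ l) {L : List R} (hL : ∀ r, r ∈ L)
    (ηr : R → Kernel (∀ j, X j) (∀ j, X j)) [∀ r, IsMarkovKernel (ηr r)]
    (hηr : ∀ r, Kernel.Invariant (ηr r) (piGibbsLaw μ (p r)))
    (η : Kernel (R → ∀ j, X j) (R → ∀ j, X j)) [IsMarkovKernel η] (hη : Kernel.Invariant η (ptbcTarget μ p)) :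
    ∃ B : ℝ, 0 ≤ B ∧ ∀ A : Set (R → ∀ j, X j), MeasurableSet A →
      0 < (ptbcTarget μ p).real A → (ptbcTarget μ p).real A < 1 →
      tauInt (setACF (η ∘ₖ replicaSweep (fun r => ηr r ∘ₖ ptbcInReplica μ p l r) L) (ptbcTarget μ p) A) ≤ 1 / 2 + B / (1 - (ptbcTarget μ p).real A) := by
  haveI := isProbabilityMeasure_ptbcTarget (μ := μ) (p := p) hm0 hMtop hmp hpM
  haveI := fun r => isMarkovKernel_ptbcInReplica (μ := μ) (l := l) hp hm0 hMtop hmp hpM r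
  obtain ⟨hinv, hν, ε', hε0, hε1, hmin⟩ := ptbc_certificate hp hm0 hMtop hmp hpM hl hL ηr hηr η hη
  have he0 : 0 < ε'.toReal := ENNReal.toReal_pos hε0.ne' (ne_top_of_le_ne_top ENNReal.one_ne_top hε1)
  have he1 : ε'.toReal ≤ 1 := ENNReal.toReal_le_of_le_ofReal zero_le_one (by simpa using hε1)
  refine ⟨1 / ε'.toReal - 1, ?_, fun A hA h0 h1 => ?_⟩
  · rw [sub_nonneg, le_div_iff₀ he0]; nlinarith
  · simpa using GeneralNCMC.tauInt_setACF_le_of_nHit (GeneralNCMC.minorised_setwise hmin) hε0 hε1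
      Nat.one_pos hinv hA h0 h1

/-- **IN PARTICULAR FOR EVERY EVENT OF ONE REPLICA** (the physical one, `r₀`): for EVERY measurable `B` with
`0 < π_{r₀}(B) < 1` (`π_{r₀} = piGibbsLaw μ (p r₀)`, the `r₀`-marginal of the target), the event `{ω | ω r₀ ∈ B}` —
a topological sector of the physical replica, say — has `τ_int ≤ 1/2 + B'/(1 − π_{r₀}(B))` under the PTBC cycle, with
the SAME `B'` for all `B` and all `r₀`. -/
theorem ptbc_physical_tauInt_setACF_le (hp : ∀ r, Measurable (p r)) (hm0 : m ≠ 0) (hMtop : M ≠ ∞)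
    (hmp : ∀ r ω, m ≤ p r ω) (hpM : ∀ r ω, p r ω ≤ M) (hl : ∀ j, j ∈ l) {L : List R} (hL : ∀ r, r ∈ L)
    (ηr : R → Kernel (∀ j, X j) (∀ j, X j)) [∀ r, IsMarkovKernel (ηr r)]
    (hηr : ∀ r, Kernel.Invariant (ηr r) (piGibbsLaw μ (p r)))
    (η : Kernel (R → ∀ j, X j) (R → ∀ j, X j)) [IsMarkovKernel η] (hη : Kernel.Invariant η (ptbcTarget μ p)) :
    ∃ B' : ℝ, 0 ≤ B' ∧ ∀ (r₀ : R) (B : Set (∀ j, X j)), MeasurableSet B →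
      0 < (piGibbsLaw μ (p r₀)).real B → (piGibbsLaw μ (p r₀)).real B < 1 →
      tauInt (setACF (η ∘ₖ replicaSweep (fun r => ηr r ∘ₖ ptbcInReplica μ p l r) L) (ptbcTarget μ p) (Function.eval r₀ ⁻¹' B)) ≤
        1 / 2 + B' / (1 - (piGibbsLaw μ (p r₀)).real B) := by
  haveI : ∀ r, IsProbabilityMeasure (piGibbsLaw μ (p r)) := fun r =>
    isProbabilityMeasure_piGibbsLaw (μ := μ) hm0 hMtop (hmp r) (hpM r)
  obtain ⟨B', hB', h⟩ := ptbc_tauInt_setACF_le hp hm0 hMtop hmp hpM hl hL ηr hηr η hη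
  refine ⟨B', hB', fun r₀ B hB h0 h1 => ?_⟩
  have hmarg : (ptbcTarget μ p).real (Function.eval r₀ ⁻¹' B) = (piGibbsLaw μ (p r₀)).real B := by
    unfold ptbcTarget
    exact pi_real_preimage_eval (π := fun r => piGibbsLaw μ (p r)) r₀ hB
  have h' := h (Function.eval r₀ ⁻¹' B) ((measurable_pi_apply r₀) hB) (hmarg ▸ h0) (hmarg ▸ h1)
  rwa [hmarg] at h'

/-- **CERTIFIED BURN-IN OF THE PTBC CHAIN FROM EVERY START**: one `B ≥ 0` with
`|E_{μ₀}[(1/n) Σ_{t<n} g(ω_t)] − ∫ g dπ| ≤ B/n` for EVERY initial law, every `[0,1]`-valued measurable `g`, `n ≥ 1`. -/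
theorem ptbc_timeAverage_bias_le (hp : ∀ r, Measurable (p r)) (hm0 : m ≠ 0) (hMtop : M ≠ ∞)
    (hmp : ∀ r ω, m ≤ p r ω) (hpM : ∀ r ω, p r ω ≤ M) (hl : ∀ j, j ∈ l) {L : List R} (hL : ∀ r, r ∈ L)
    (ηr : R → Kernel (∀ j, X j) (∀ j, X j)) [∀ r, IsMarkovKernel (ηr r)]
    (hηr : ∀ r, Kernel.Invariant (ηr r) (piGibbsLaw μ (p r)))
    (η : Kernel (R → ∀ j, X j) (R → ∀ j, X j)) [IsMarkovKernel η] (hη : Kernel.Invariant η (ptbcTarget μ p))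
    [∀ r, IsMarkovKernel (ptbcInReplica μ p l r)] :
    ∃ B : ℝ, 0 ≤ B ∧ ∀ (μ₀ : Measure (R → ∀ j, X j)) [IsProbabilityMeasure μ₀]
      (g : (R → ∀ j, X j) → ℝ), Measurable g → (∀ ω, 0 ≤ g ω) → (∀ ω, g ω ≤ 1) →
      ∀ n : ℕ, n ≠ 0 →
      |∫ x, (∑ t ∈ Finset.range n, g (x t)) / n
          ∂(Kernel.trajMeasure (X := fun _ : ℕ => (R → ∀ j, X j)) μ₀
              (fun t : ℕ => (η ∘ₖ replicaSweep (fun r => ηr r ∘ₖ ptbcInReplica μ p l r) L).comap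
                (fun h : (i : ↥(Finset.Iic t)) → (R → ∀ j, X j) =>
                  h ⟨t, Finset.mem_Iic.2 le_rfl⟩) (measurable_pi_apply _)))
        - ∫ ω, g ω ∂(ptbcTarget μ p)| ≤ B / n := by
  haveI := isProbabilityMeasure_ptbcTarget (μ := μ) (p := p) hm0 hMtop hmp hpM
  obtain ⟨hinv, hν, ε', hε0, hε1, hmin⟩ := ptbc_certificate hp hm0 hMtop hmp hpM hl hL ηr hηr η hη
  have he0 : 0 < ε'.toReal := ENNReal.toReal_pos hε0.ne' (ne_top_of_le_ne_top ENNReal.one_ne_top hε1)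
  refine ⟨1 / ε'.toReal, by positivity, fun μ₀ _ g hg h0 h1 n hn0 => ?_⟩
  calc _ ≤ ((1 : ℕ) : ℝ) / (ε'.toReal * n) :=
        GeneralNCMC.chain_timeAverage_bias_le_of_nHit (GeneralNCMC.minorised_setwise hmin) hε0 hε1 Nat.one_pos
          hinv μ₀ hg h0 h1 hn0
    _ = 1 / ε'.toReal / n := by rw [Nat.cast_one, div_div]

/-- **THE CLT FOR TIME AVERAGES OF THE PTBC CHAIN, FROM EVERY INITIAL LAW** (`|f| ≤ C` measurable on the joint
state — e.g. an observable of the physical replica; `Y ~ N(0, σ²_f)`): `(√n)⁻¹ Σ_{t<n} (f(ω_t) − π f) ⇒ Y`. -/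
theorem ptbc_timeAverage_clt (hp : ∀ r, Measurable (p r)) (hm0 : m ≠ 0) (hMtop : M ≠ ∞)
    (hmp : ∀ r ω, m ≤ p r ω) (hpM : ∀ r ω, p r ω ≤ M) (hl : ∀ j, j ∈ l) {L : List R} (hL : ∀ r, r ∈ L)
    (ηr : R → Kernel (∀ j, X j) (∀ j, X j)) [∀ r, IsMarkovKernel (ηr r)]
    (hηr : ∀ r, Kernel.Invariant (ηr r) (piGibbsLaw μ (p r)))
    (η : Kernel (R → ∀ j, X j) (R → ∀ j, X j)) [IsMarkovKernel η] (hη : Kernel.Invariant η (ptbcTarget μ p))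
    [∀ r, IsMarkovKernel (ptbcInReplica μ p l r)]
    {f : (R → ∀ j, X j) → ℝ} (hf : Measurable f) {C : ℝ} (hC : ∀ ω, |f ω| ≤ C)
    (μ₀ : Measure (R → ∀ j, X j)) [IsProbabilityMeasure μ₀]
    [IsProbabilityMeasure (Kernel.trajMeasure (X := fun _ : ℕ => (R → ∀ j, X j)) μ₀
              (fun t : ℕ => (η ∘ₖ replicaSweep (fun r => ηr r ∘ₖ ptbcInReplica μ p l r) L).comap
                (fun h : (i : ↥(Finset.Iic t)) → (R → ∀ j, X j) =>
                  h ⟨t, Finset.mem_Iic.2 le_rfl⟩) (measurable_pi_apply _)))]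
    {Ω' : Type*} [MeasurableSpace Ω'] {P' : Measure Ω'} [IsProbabilityMeasure P'] {Y : Ω' → ℝ}
    (hY : HasLaw Y (gaussianReal 0 (Real.toNNReal
      ((∫ y, (f y - ∫ z, f z ∂(ptbcTarget μ p)) ^ 2 ∂(ptbcTarget μ p))
              + 2 * ∑' k, ∫ y, (f y - ∫ z, f z ∂(ptbcTarget μ p))
                * (kop (η ∘ₖ replicaSweep (fun r => ηr r ∘ₖ ptbcInReplica μ p l r) L))^[k + 1]
                  (fun y => f y - ∫ z, f z ∂(ptbcTarget μ p)) y ∂(ptbcTarget μ p)))) P') :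
    TendstoInDistribution (fun (n : ℕ) (x : ℕ → (R → ∀ j, X j)) =>
        (Real.sqrt n)⁻¹ * ∑ t ∈ Finset.range n, (f (x t) - ∫ z, f z ∂(ptbcTarget μ p)))
      atTop Y (fun _ => (Kernel.trajMeasure (X := fun _ : ℕ => (R → ∀ j, X j)) μ₀
              (fun t : ℕ => (η ∘ₖ replicaSweep (fun r => ηr r ∘ₖ ptbcInReplica μ p l r) L).comap
                (fun h : (i : ↥(Finset.Iic t)) → (R → ∀ j, X j) =>
                  h ⟨t, Finset.mem_Iic.2 le_rfl⟩) (measurable_pi_apply _)))) P' := by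
  haveI := isProbabilityMeasure_ptbcTarget (μ := μ) (p := p) hm0 hMtop hmp hpM
  obtain ⟨hinv, hν, ε', hε0, -, hmin⟩ := ptbc_certificate hp hm0 hMtop hmp hpM hl hL ηr hηr η hη
  exact GeneralNCMC.tendstoInDistribution_timeAverage_of_nHit hinv hε0.ne' hmin Nat.one_pos hf hC μ₀ hY

/-- **BATCH MEANS ESTIMATE `σ²_f` CONSISTENTLY ALONG THE PTBC CHAIN, FROM EVERY INITIAL LAW**: `a b · SE²_BM → σ²_f`
in probability as `a, b → ∞`. -/
theorem ptbc_batchMeans_tendstoInMeasure (hp : ∀ r, Measurable (p r)) (hm0 : m ≠ 0) (hMtop : M ≠ ∞)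
    (hmp : ∀ r ω, m ≤ p r ω) (hpM : ∀ r ω, p r ω ≤ M) (hl : ∀ j, j ∈ l) {L : List R} (hL : ∀ r, r ∈ L)
    (ηr : R → Kernel (∀ j, X j) (∀ j, X j)) [∀ r, IsMarkovKernel (ηr r)]
    (hηr : ∀ r, Kernel.Invariant (ηr r) (piGibbsLaw μ (p r)))
    (η : Kernel (R → ∀ j, X j) (R → ∀ j, X j)) [IsMarkovKernel η] (hη : Kernel.Invariant η (ptbcTarget μ p))
    [∀ r, IsMarkovKernel (ptbcInReplica μ p l r)]
    {f : (R → ∀ j, X j) → ℝ} (hf : Measurable f) {C : ℝ} (hC : ∀ ω, |f ω| ≤ C)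
    (μ₀ : Measure (R → ∀ j, X j)) [IsProbabilityMeasure μ₀]
    {a b' : ℕ → ℕ} (ha : Tendsto a atTop atTop) (hb' : Tendsto b' atTop atTop) :
    TendstoInMeasure (Kernel.trajMeasure (X := fun _ : ℕ => (R → ∀ j, X j)) μ₀
              (fun t : ℕ => (η ∘ₖ replicaSweep (fun r => ηr r ∘ₖ ptbcInReplica μ p l r) L).comap
                (fun h : (i : ↥(Finset.Iic t)) → (R → ∀ j, X j) =>
                  h ⟨t, Finset.mem_Iic.2 le_rfl⟩) (measurable_pi_apply _)))
      (fun (n : ℕ) (x : ℕ → (R → ∀ j, X j)) => ((b' n * a n : ℕ) : ℝ)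
        * replicaSEsq (fun j (x : ℕ → (R → ∀ j, X j)) =>
            (∑ i ∈ Finset.range (b' n), f (x (b' n * j + i))) / (b' n)) (a n) x)
      atTop (fun _ => (∫ y, (f y - ∫ z, f z ∂(ptbcTarget μ p)) ^ 2 ∂(ptbcTarget μ p))
              + 2 * ∑' k, ∫ y, (f y - ∫ z, f z ∂(ptbcTarget μ p))
                * (kop (η ∘ₖ replicaSweep (fun r => ηr r ∘ₖ ptbcInReplica μ p l r) L))^[k + 1]
                  (fun y => f y - ∫ z, f z ∂(ptbcTarget μ p)) y ∂(ptbcTarget μ p)) := by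
  haveI := isProbabilityMeasure_ptbcTarget (μ := μ) (p := p) hm0 hMtop hmp hpM
  obtain ⟨hinv, hν, ε', hε0, hε1, hmin⟩ := ptbc_certificate hp hm0 hMtop hmp hpM hl hL ηr hηr η hη
  exact Scoring.chain_batchMeans_sigmaHat_tendstoInMeasure_of_nHit hinv (GeneralNCMC.minorised_setwise hmin)
    hε0 hε1 Nat.one_pos hf hC μ₀ ha hb'

/-- **THE BATCH-MEANS INTERVAL OF A PTBC RUN IS ASYMPTOTICALLY EXACT** (`σ²_f > 0`, `a, b → ∞`, any initial law,
`z > 0`): `P_{μ₀}(|√(ab) (f̄_{ab} − π f)| ≤ z σ̂_BM) → (gaussianReal 0 1)[−z, z]`. -/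
theorem ptbc_batchMeans_coverage (hp : ∀ r, Measurable (p r)) (hm0 : m ≠ 0) (hMtop : M ≠ ∞)
    (hmp : ∀ r ω, m ≤ p r ω) (hpM : ∀ r ω, p r ω ≤ M) (hl : ∀ j, j ∈ l) {L : List R} (hL : ∀ r, r ∈ L)
    (ηr : R → Kernel (∀ j, X j) (∀ j, X j)) [∀ r, IsMarkovKernel (ηr r)]
    (hηr : ∀ r, Kernel.Invariant (ηr r) (piGibbsLaw μ (p r)))
    (η : Kernel (R → ∀ j, X j) (R → ∀ j, X j)) [IsMarkovKernel η] (hη : Kernel.Invariant η (ptbcTarget μ p))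
    [∀ r, IsMarkovKernel (ptbcInReplica μ p l r)]
    {f : (R → ∀ j, X j) → ℝ} (hf : Measurable f) {C : ℝ} (hC : ∀ ω, |f ω| ≤ C)
    (hσ : 0 < (∫ y, (f y - ∫ z, f z ∂(ptbcTarget μ p)) ^ 2 ∂(ptbcTarget μ p))
              + 2 * ∑' k, ∫ y, (f y - ∫ z, f z ∂(ptbcTarget μ p))
                * (kop (η ∘ₖ replicaSweep (fun r => ηr r ∘ₖ ptbcInReplica μ p l r) L))^[k + 1]
                  (fun y => f y - ∫ z, f z ∂(ptbcTarget μ p)) y ∂(ptbcTarget μ p))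
    (μ₀ : Measure (R → ∀ j, X j)) [IsProbabilityMeasure μ₀]
    {a b' : ℕ → ℕ} (ha : Tendsto a atTop atTop) (hb' : Tendsto b' atTop atTop) {z : ℝ} (hz : 0 < z) :
    Tendsto (fun n : ℕ => (Kernel.trajMeasure (X := fun _ : ℕ => (R → ∀ j, X j)) μ₀
              (fun t : ℕ => (η ∘ₖ replicaSweep (fun r => ηr r ∘ₖ ptbcInReplica μ p l r) L).comap
                (fun h : (i : ↥(Finset.Iic t)) → (R → ∀ j, X j) =>
                  h ⟨t, Finset.mem_Iic.2 le_rfl⟩) (measurable_pi_apply _))).real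
      {x | |((Real.sqrt ((b' n * a n : ℕ) : ℝ))⁻¹
          * ∑ t ∈ Finset.range (b' n * a n), (f (x t) - ∫ z, f z ∂(ptbcTarget μ p)))
        / Real.sqrt (((b' n * a n : ℕ) : ℝ)
          * replicaSEsq (fun j (x : ℕ → (R → ∀ j, X j)) =>
              (∑ i ∈ Finset.range (b' n), f (x (b' n * j + i))) / (b' n)) (a n) x)| ≤ z})
      atTop (𝓝 ((gaussianReal 0 1).real (Set.Icc (-z) z))) := by
  haveI := isProbabilityMeasure_ptbcTarget (μ := μ) (p := p) hm0 hMtop hmp hpM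
  obtain ⟨hinv, hν, ε', hε0, hε1, hmin⟩ := ptbc_certificate hp hm0 hMtop hmp hpM hl hL ηr hηr η hη
  exact Scoring.doeblinPower_batchMeans_studentized_coverage hinv hmin hε0 hε1 Nat.one_pos hf hC hσ μ₀ ha hb' hz

/-- **THE REPORTED `τ̂_int = σ̂²_BM/(2 v̂)` OF A PTBC RUN IS CONSISTENT** (`Var_π f ≠ 0`, `a, b → ∞`, any initial law):
`σ̂²/(2 v̂) → τ_int(ρ_f) = 1/2 + Σ_{t≥1} ρ_f(t)` in probability. -/
theorem ptbc_tauInt_tendstoInMeasure (hp : ∀ r, Measurable (p r)) (hm0 : m ≠ 0) (hMtop : M ≠ ∞)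
    (hmp : ∀ r ω, m ≤ p r ω) (hpM : ∀ r ω, p r ω ≤ M) (hl : ∀ j, j ∈ l) {L : List R} (hL : ∀ r, r ∈ L)
    (ηr : R → Kernel (∀ j, X j) (∀ j, X j)) [∀ r, IsMarkovKernel (ηr r)]
    (hηr : ∀ r, Kernel.Invariant (ηr r) (piGibbsLaw μ (p r)))
    (η : Kernel (R → ∀ j, X j) (R → ∀ j, X j)) [IsMarkovKernel η] (hη : Kernel.Invariant η (ptbcTarget μ p))
    [∀ r, IsMarkovKernel (ptbcInReplica μ p l r)]
    {f : (R → ∀ j, X j) → ℝ} (hf : Measurable f) {C : ℝ} (hC : ∀ ω, |f ω| ≤ C)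
    (hvar : autocov (η ∘ₖ replicaSweep (fun r => ηr r ∘ₖ ptbcInReplica μ p l r) L)
        (ptbcTarget μ p) (fun y => f y - ∫ z, f z ∂(ptbcTarget μ p)) 0 ≠ 0)
    (μ₀ : Measure (R → ∀ j, X j)) [IsProbabilityMeasure μ₀]
    {a b' : ℕ → ℕ} (ha : Tendsto a atTop atTop) (hb' : Tendsto b' atTop atTop) :
    TendstoInMeasure (Kernel.trajMeasure (X := fun _ : ℕ => (R → ∀ j, X j)) μ₀
              (fun t : ℕ => (η ∘ₖ replicaSweep (fun r => ηr r ∘ₖ ptbcInReplica μ p l r) L).comap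
                (fun h : (i : ↥(Finset.Iic t)) → (R → ∀ j, X j) =>
                  h ⟨t, Finset.mem_Iic.2 le_rfl⟩) (measurable_pi_apply _)))
      (fun (n : ℕ) (x : ℕ → (R → ∀ j, X j)) =>
        (((b' n * a n : ℕ) : ℝ)
          * replicaSEsq (fun j (x : ℕ → (R → ∀ j, X j)) =>
              (∑ i ∈ Finset.range (b' n), f (x (b' n * j + i))) / (b' n)) (a n) x)
        / (2 * ((∑ t ∈ Finset.range (b' n * a n), f (x t) ^ 2) / ((b' n * a n : ℕ) : ℝ)
            - ((∑ t ∈ Finset.range (b' n * a n), f (x t)) / ((b' n * a n : ℕ) : ℝ)) ^ 2)))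
      atTop (fun _ => tauInt (fun t =>
        autocov (η ∘ₖ replicaSweep (fun r => ηr r ∘ₖ ptbcInReplica μ p l r) L)
            (ptbcTarget μ p) (fun y => f y - ∫ z, f z ∂(ptbcTarget μ p)) t
          / autocov (η ∘ₖ replicaSweep (fun r => ηr r ∘ₖ ptbcInReplica μ p l r) L)
            (ptbcTarget μ p) (fun y => f y - ∫ z, f z ∂(ptbcTarget μ p)) 0)) := by
  haveI := isProbabilityMeasure_ptbcTarget (μ := μ) (p := p) hm0 hMtop hmp hpM
  obtain ⟨hinv, hν, ε', hε0, hε1, hmin⟩ := ptbc_certificate hp hm0 hMtop hmp hpM hl hL ηr hηr η hη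
  exact Scoring.chain_batchMeans_tauInt_tendstoInMeasure_of_nHit hinv hmin hε0 hε1 Nat.one_pos hf hC hvar μ₀ ha hb'

end PTBC

end Summit.Ventures.LatticeQCDFlow.Exactness

end
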